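import Mathlib
import HarnessLib
import Literature.MathematicalPhysics.QuantumLattice.HubbardTorus2DTiling
import Literature.MathematicalPhysics.QuantumLattice.HubbardOneParticleCost
import Summits.HubbardSuperconductivity.HubbardSuperconductivity.Theorems.ThermalWedgeTwSeededEnsembleEquivalenceCloserSecant

/-!
# Route `ThermalWedge`, item `stmt-HubbardSuperconductivity-1702` (`TwPureThermalBound`):
# lemmas for the GC-mixing construction (row patterns, the row count, the one-particle walk, row mixing)

Support file (`--supports stmt-HubbardSuperconductivity-1702`; no definition; the route file is NOT
imported). Finite-volume ingredients of the GC-mixing proof of the `T = 0` equivalence of ensembles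
(module `…TwPureThermalBoundMixing`), for the sector energies `E(N) = groundEnergyAt (fermionRectTorusGraph · ·) 1 U N`
of the Hubbard model on rectangular tori:

* `ptbm_sum_fin_ite`: sums of a two-valued step pattern over `Fin n`;
* `ptbm_exists_rowCount`: for the progression `f(m) = n(mN_a + (n−m)N_b)` (`N_a ≤ N_b`) every target is
  within one step `n(N_b − N_a)` of some `f(m)`, up to the overshoots beyond `f(n) = n²N_a`, `f(0) = n²N_b`;
* `ptbm_walk`: on the torus `L × L`, `E(N') ≤ E(N) + 144(2+|U|)|N' − N|` for sectors with
  `L²/4 ≤ N, N' ≤ 3L²/2` (iterated one-particle cost `groundEnergyAt_succ_le/pred_le`, degree `≤ 4`);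
* `ptbm_rowMixing`: tiling `nM × nM` by `M × M` blocks with `m` block-rows at `N_a` particles and `n − m`
  at `N_b`: `E_{nM}(n(mN_a + (n−m)N_b)) ≤ n(mE_M(N_a) + (n−m)E_M(N_b)) + 16M(n−1)n`
  (`groundEnergyAt_square_tiling`).

Ruelle, *Statistical Mechanics: Rigorous Results* (1969), §2.2 and §3.4. [folklore]
-/

set_option linter.dupNamespace false

noncomputable section

namespace Summit.HubbardSuperconductivity.HubbardSuperconductivity.Theorems

open Literature.MathematicalPhysics.QuantumLattice Literature.Probability.LatticeModels Matrix Finset Filter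
open Literature.MathematicalPhysics.QuantumLattice.ThermodynamicLimit
open Summit.HubbardSuperconductivity.HubbardSuperconductivity.Theorems.TwSeededEnsembleEquivalence.ExposedDensity
open scoped ComplexOrder Topology

/-! ### Bookkeeping: two-valued row patterns -/

/-- A sum over `Fin n` of a two-valued step pattern: `m` copies of `x`, then `n − m` copies of `y`.
[folklore] -/
theorem ptbm_sum_fin_ite {R : Type*} [AddCommMonoid R] (n m : ℕ) (hm : m ≤ n) (x y : R) :
    ∑ i : Fin n, (if (i : ℕ) < m then x else y) = m • x + (n - m) • y := by
  rw [Fin.sum_univ_eq_sum_range (fun i => if i < m then x else y) n,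
    ← Finset.sum_range_add_sum_Ico _ hm]
  have h1 : ∑ i ∈ range m, (if i < m then x else y) = m • x := by
    rw [Finset.sum_congr rfl (fun i hi => if_pos (Finset.mem_range.1 hi)), sum_const, card_range]
  have h2 : ∑ i ∈ Ico m n, (if i < m then x else y) = (n - m) • y := by
    rw [Finset.sum_congr rfl (fun i hi => if_neg (not_lt.2 (Finset.mem_Ico.1 hi).1)), sum_const,
      Nat.card_Ico]
  rw [h1, h2]

/-- **Choosing the number of `a`-rows.** For the arithmetic progression
`f(m) = n(m N_a + (n − m) N_b)` (`N_a ≤ N_b`, `0 ≤ m ≤ n`), every target `T` is within one step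
`n(N_b − N_a)` of some value `f(m)`, up to the overshoots beyond the end values `f(n) = n²N_a` and
`f(0) = n²N_b`: there is `m ≤ n` with `f(m) ≤ T + n(N_b − N_a) + (n²N_a ∸ T)` and
`T ≤ f(m) + (T ∸ n²N_b)`. [folklore] -/
theorem ptbm_exists_rowCount (n Na Nb T : ℕ) (hab : Na ≤ Nb) :
    ∃ m : ℕ, m ≤ n ∧ n * (m * Na + (n - m) * Nb) ≤ T + n * (Nb - Na) + (n * (n * Na) - T) ∧
      T ≤ n * (m * Na + (n - m) * Nb) + (T - n * (n * Nb)) := by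
  classical
  set f : ℕ → ℕ := fun m => n * (m * Na + (n - m) * Nb) with hf
  -- one step of the progression
  have hstep : ∀ m, m + 1 ≤ n → f m = f (m + 1) + n * (Nb - Na) := by
    intro m hm
    simp only [hf]
    have h1 : n - m = (n - (m + 1)) + 1 := by omega
    rw [h1]
    zify [hab, hm, (by omega : m ≤ n)]
    ring
  by_cases hT : T ≤ f n
  · refine ⟨n, le_rfl, ?_, ?_⟩
    · show f n ≤ T + n * (Nb - Na) + (n * (n * Na) - T)
      have : f n = n * (n * Na) := by simp [hf]
      omega
    · show T ≤ f n + (T - n * (n * Nb))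
      omega
  · push Not at hT
    by_cases hex : ∃ m, m ≤ n ∧ T ≤ f m
    · obtain ⟨m₁, hm₁, hTm₁⟩ := hex
      set m := Nat.findGreatest (fun m => T ≤ f m) n with hmdef
      have hPm : T ≤ f m := Nat.findGreatest_spec (P := fun m => T ≤ f m) hm₁ hTm₁
      have hmn : m ≤ n := Nat.findGreatest_le n
      have hmlt : m < n := by
        rcases lt_or_eq_of_le hmn with h | h
        · exact h
        · exact absurd (h ▸ hPm) (not_le.2 hT)
      have hnot : ¬ T ≤ f (m + 1) :=
        Nat.findGreatest_is_greatest (P := fun m => T ≤ f m) (Nat.lt_succ_self m) hmlt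
      push Not at hnot
      refine ⟨m, hmn, ?_, ?_⟩
      · show f m ≤ T + n * (Nb - Na) + (n * (n * Na) - T)
        have := hstep m hmlt
        omega
      · show T ≤ f m + (T - n * (n * Nb))
        omega
    · push Not at hex
      have h0 := hex 0 (Nat.zero_le n)
      refine ⟨0, Nat.zero_le n, ?_, ?_⟩
      · show f 0 ≤ T + n * (Nb - Na) + (n * (n * Na) - T)
        omega
      · show T ≤ f 0 + (T - n * (n * Nb))
        have : f 0 = n * (n * Nb) := by simp [hf]
        omega

/-! ### The one-particle walk on the torus `L × L` at densities in `[1/4, 3/2]` -/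

/-- **One-particle walk.** On the rectangular torus `L × L` (`U` arbitrary, `t = 1`), moving between two
sectors `N, N'` with `L²/4 ≤ N, N' ≤ 3L²/2` costs at most `144(2+|U|)` per particle:
`E(N') ≤ E(N) + 144(2+|U|)|N' − N|` (iterate `groundEnergyAt_succ_le` / `groundEnergyAt_pred_le`, degree
`≤ 4`). [folklore] -/
theorem ptbm_walk (L : ℕ) (U : ℝ) {N N' : ℕ} (hN1 : L ^ 2 ≤ 4 * N) (hN2 : 2 * N ≤ 3 * L ^ 2)
    (hN1' : L ^ 2 ≤ 4 * N') (hN2' : 2 * N' ≤ 3 * L ^ 2) :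
    groundEnergyAt (fermionRectTorusGraph L L) 1 U N' ≤
      groundEnergyAt (fermionRectTorusGraph L L) 1 U N + 144 * (2 + |U|) * |(N' : ℝ) - N| := by
  set E : ℕ → ℝ := fun K => groundEnergyAt (fermionRectTorusGraph L L) 1 U K with hE
  have hcard : Fintype.card (Fin L ×ₗ Fin L) = L ^ 2 := by rw [card_rectSites, sq]
  have hΔ : ∀ p : Fin L ×ₗ Fin L, #{q | (fermionRectTorusGraph L L).Adj p q} ≤ 4 :=
    card_filter_fermionRectTorusGraph_adj_le L L
  have hK : ((2 * 4 + 1 : ℕ) : ℝ) * (2 * (2 * |(1 : ℝ)| + |U|)) = 18 * (2 + |U|) := by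
    rw [abs_one]; push_cast; ring
  have hU2 : 0 ≤ 2 + |U| := by positivity
  by_cases hL : L = 0
  · subst hL
    have h0 : N = 0 := by omega
    have h0' : N' = 0 := by omega
    subst h0; subst h0'
    simp
  have hLpos : (0 : ℝ) < (L : ℝ) ^ 2 := by positivity
  -- single steps
  have hup : ∀ K : ℕ, L ^ 2 ≤ 4 * K → 2 * (K + 1) ≤ 3 * L ^ 2 → E (K + 1) ≤ E K + 144 * (2 + |U|) := by
    intro K _ hK2
    have hKlt : K < 2 * Fintype.card (Fin L ×ₗ Fin L) := by rw [hcard]; omega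
    have h := groundEnergyAt_succ_le (fermionRectTorusGraph L L) hΔ 1 U hKlt
    rw [hK, hcard] at h
    have hden : (L : ℝ) ^ 2 / 2 ≤ 2 * ((L ^ 2 : ℕ) : ℝ) - K := by
      have : (2 * (K + 1) : ℝ) ≤ 3 * (L : ℝ) ^ 2 := by exact_mod_cast hK2
      push_cast; linarith
    have hdenpos : 0 < 2 * ((L ^ 2 : ℕ) : ℝ) - K := lt_of_lt_of_le (by positivity) hden
    have hfrac : 18 * (2 + |U|) * (2 * ((L ^ 2 : ℕ) : ℝ)) / (2 * ((L ^ 2 : ℕ) : ℝ) - K) ≤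
        144 * (2 + |U|) := by
      rw [div_le_iff₀ hdenpos]
      have : 18 * (2 + |U|) * (2 * ((L ^ 2 : ℕ) : ℝ)) = 144 * (2 + |U|) * ((L:ℝ) ^ 2 / 4) := by
        push_cast; ring
      rw [this]
      exact mul_le_mul_of_nonneg_left (by linarith) (by positivity)
    exact h.trans (by linarith)
  have hdown : ∀ K : ℕ, L ^ 2 ≤ 4 * (K - 1) → 2 * K ≤ 3 * L ^ 2 → 1 ≤ K → E (K - 1) ≤ E K + 144 * (2 + |U|) := by
    intro K hK1 hK2 hK0
    have hKle : K ≤ 2 * Fintype.card (Fin L ×ₗ Fin L) := by rw [hcard]; omega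
    have h := groundEnergyAt_pred_le (fermionRectTorusGraph L L) hΔ 1 U hK0 hKle
    rw [hK, hcard] at h
    have hden : (L : ℝ) ^ 2 / 4 ≤ K := by
      have : ((L ^ 2 : ℕ) : ℝ) ≤ 4 * ((K - 1 : ℕ) : ℝ) := by exact_mod_cast hK1
      have h2 : ((K - 1 : ℕ) : ℝ) ≤ K := by exact_mod_cast Nat.sub_le K 1
      push_cast at this; linarith
    have hKpos : (0 : ℝ) < K := lt_of_lt_of_le (by positivity) hden
    have hfrac : 18 * (2 + |U|) * (2 * ((L ^ 2 : ℕ) : ℝ)) / K ≤ 144 * (2 + |U|) := by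
      rw [div_le_iff₀ hKpos]
      have : 18 * (2 + |U|) * (2 * ((L ^ 2 : ℕ) : ℝ)) = 144 * (2 + |U|) * ((L:ℝ) ^ 2 / 4) := by
        push_cast; ring
      rw [this]
      exact mul_le_mul_of_nonneg_left hden (by positivity)
    exact h.trans (by linarith)
  rcases le_total N N' with hle | hle
  · -- walk up from `N` to `N'`
    obtain ⟨k, rfl⟩ := Nat.exists_eq_add_of_le hle
    have hw := walkUp E (144 * (2 + |U|)) N k fun n hn1 hn2 => hup n (by omega) (by omega)
    have habs : |((N + k : ℕ) : ℝ) - N| = k := by push_cast; rw [add_sub_cancel_left, Nat.abs_cast]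
    rw [habs]
    simpa [hE] using hw
  · -- walk down from `N` to `N'`
    obtain ⟨k, rfl⟩ := Nat.exists_eq_add_of_le hle
    have hw := walkDown E (144 * (2 + |U|)) N' k fun n hn1 hn2 => hdown n (by omega) (by omega) (by omega)
    have habs : |((N' : ℕ) : ℝ) - ((N' + k : ℕ) : ℝ)| = k := by
      push_cast; rw [sub_add_cancel_left, abs_neg, Nat.abs_cast]
    rw [habs]
    simpa [hE] using hw

/-! ### The row-mixing tiling -/

/-- **Row mixing.** Tiling the torus `nM × nM` (`n = k + 1`) by `M × M` blocks, the first `m` block-rows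
carrying `N_a` particles per block and the remaining `n − m` rows `N_b` (`N_a, N_b ≤ 2M²`):
`E_{nM}(n(mN_a + (n−m)N_b)) ≤ n(m E_M(N_a) + (n−m) E_M(N_b)) + 16 M k n`. [folklore] -/
theorem ptbm_rowMixing (M k m : ℕ) (hm : m ≤ k + 1) (U : ℝ) {Na Nb : ℕ} (hNa : Na ≤ 2 * (M * M))
    (hNb : Nb ≤ 2 * (M * M)) :
    groundEnergyAt (fermionRectTorusGraph ((k + 1) * M) ((k + 1) * M)) 1 U
        ((k + 1) * (m * Na + (k + 1 - m) * Nb)) ≤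
      (k + 1 : ℕ) * (m * groundEnergyAt (fermionRectTorusGraph M M) 1 U Na +
          ((k + 1 - m : ℕ) : ℝ) * groundEnergyAt (fermionRectTorusGraph M M) 1 U Nb) +
        16 * M * k * (k + 1) := by
  set Ns : Fin (k + 1) → Fin (k + 1) → ℕ := fun i _ => if (i : ℕ) < m then Na else Nb with hNs
  have hNs2 : ∀ i j, Ns i j ≤ 2 * (M * M) := by
    intro i j; simp only [hNs]; split_ifs <;> assumption
  have h := groundEnergyAt_square_tiling M 1 U k Ns hNs2
  have hsumN : ∑ i, ∑ j, Ns i j = (k + 1) * (m * Na + (k + 1 - m) * Nb) := by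
    simp only [hNs, sum_const, card_univ, Fintype.card_fin, smul_eq_mul]
    rw [← Finset.mul_sum]
    congr 1
    have := ptbm_sum_fin_ite (k + 1) m hm Na Nb
    simp only [smul_eq_mul] at this
    rw [this]
  have hsumE : ∑ i, ∑ j, groundEnergyAt (fermionRectTorusGraph M M) 1 U (Ns i j) =
      (k + 1 : ℕ) * (m * groundEnergyAt (fermionRectTorusGraph M M) 1 U Na +
        ((k + 1 - m : ℕ) : ℝ) * groundEnergyAt (fermionRectTorusGraph M M) 1 U Nb) := by
    have hin : ∀ i j, groundEnergyAt (fermionRectTorusGraph M M) 1 U (Ns i j) =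
        if (i : ℕ) < m then groundEnergyAt (fermionRectTorusGraph M M) 1 U Na
          else groundEnergyAt (fermionRectTorusGraph M M) 1 U Nb := by
      intro i j; simp only [hNs]; split_ifs <;> rfl
    simp only [hin, sum_const, card_univ, Fintype.card_fin]
    rw [← Finset.smul_sum, ptbm_sum_fin_ite (k + 1) m hm, nsmul_eq_mul, nsmul_eq_mul, nsmul_eq_mul]
  rw [hsumN, hsumE, abs_one] at h
  linarith

end Summit.HubbardSuperconductivity.HubbardSuperconductivity.Theorems

end
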